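import Summits.SmoothPoincare4.SmoothPoincare4.Theses.SullivanDual
import Literature.Geometry.Symplectic.TamingWitness
import Literature.Geometry.Symplectic.GromovR4StdModel

/-!
# Collar lemma for taming witnesses (1/4): preliminaries

Support file for the stub `stub_collar` of the line `Sketch` (pencil-incompleteness) of the crux
`WitnessCharge` (`stmt-SmoothPoincare4-7824`, thesis `SullivanDual`). Elementary facts used by
the collar lemma, kept free of definitions:

* `exists_smooth_profile` — for `a < b` a `C^∞` monotone cut-off `f : ℝ → ℝ`, locally `0` below
  `a`, locally `1` above `b`, positive on `(a, ∞)`, with `0 ≤ f` and `0 ≤ f'`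
  (Mathlib's `Real.smoothTransition` after an affine change of variable);
* `exists_bound_of_injective`, `bound_of_norm_sub_le` — an injective endomorphism of `ℝ⁴` is
  bounded below, `‖u‖ ≤ K ‖B u‖`, and such a bound survives (with constant `2K`) perturbations
  of operator norm `≤ (2K)⁻¹`;
* `fderiv_inversion_injective` — the differential of the inversion `ι` of `ℝ⁴ ∖ 0` is injective
  (`ι ∘ ι = id`);
* `exists_const_of_isCompact` — a constant-indexed property, monotone in the constant and valid
  with one constant near each point of a compact set, holds with one constant on the set;
* `tamingWitness_nonneg_of_semipositive` — **positivity**: if a smooth form tames `J`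
  everywhere, a taming witness is `≥ 0` on every smooth form that is `J`-semipositive off the
  ball ((W1) applied to `α + s β`, `s → 0⁺`); `stub_collar_positivity` is its closed form on a
  punctured homotopy sphere (the registered sub-goal of this file).

## References

* D. Sullivan, *Cycles for the dynamical study of foliated manifolds and complex manifolds*,
  Invent. Math. 36 (1976), Thm. I.7. [Sullivan1976]
* M. Gromov, *Pseudo holomorphic curves in symplectic manifolds*, Invent. Math. 82 (1985),
  §0.3.C. [Gromov1985]
-/

noncomputable section

-- Justification: all stub files of the line share the namespace of the skeleton
-- (`…Theorems.WitnessCharge.PencilIncompleteness`), which repeats the component `SmoothPoincare4`.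
set_option linter.dupNamespace false

open scoped Manifold ContDiff Topology RealInnerProductSpace
open Set Filter Literature.Geometry.Kaehler Literature.Geometry.Symplectic
  Literature.Topology.FourManifolds

namespace Summit.SmoothPoincare4.SmoothPoincare4.Theorems.WitnessCharge.PencilIncompleteness

/-! ### A smooth monotone cut-off -/

/-- **A smooth monotone cut-off.** For `a < b` there is a `C^∞` monotone `f : ℝ → ℝ` with
`0 ≤ f`, `0 ≤ f'`, `f ≡ 0` near every `t < a`, `f ≡ 1` near every `t > b`, and `f > 0` on
`(a, ∞)` (`t ↦ smoothTransition ((t - a)/(b - a))`). [folklore] -/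
theorem exists_smooth_profile {a b : ℝ} (hab : a < b) :
    ∃ f : ℝ → ℝ, ContDiff ℝ ∞ f ∧ Monotone f ∧ (∀ t, 0 ≤ f t) ∧ (∀ t, 0 ≤ deriv f t) ∧
      (∀ t, t < a → f =ᶠ[𝓝 t] fun _ => 0) ∧ (∀ t, b < t → f =ᶠ[𝓝 t] fun _ => 1) ∧
      (∀ t, a < t → 0 < f t) := by
  have hba : 0 < b - a := sub_pos.2 hab
  refine ⟨fun t => Real.smoothTransition ((t - a) / (b - a)), ?_, ?_, ?_, ?_, ?_, ?_, ?_⟩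
  · exact Real.smoothTransition.contDiff.comp ((contDiff_id.sub contDiff_const).div_const _)
  · exact fun s t hst =>
      Real.smoothTransition.monotone (div_le_div_of_nonneg_right (by linarith) hba.le)
  · exact fun t => Real.smoothTransition.nonneg _
  · intro t
    have hm : Monotone fun t => Real.smoothTransition ((t - a) / (b - a)) := fun s t hst =>
      Real.smoothTransition.monotone (div_le_div_of_nonneg_right (by linarith) hba.le)
    exact hm.deriv_nonneg
  · intro t ht
    filter_upwards [Iio_mem_nhds ht] with s hs
    exact Real.smoothTransition.zero_of_nonpos
      (div_nonpos_of_nonpos_of_nonneg (by linarith [mem_Iio.1 hs]) hba.le)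
  · intro t ht
    filter_upwards [Ioi_mem_nhds ht] with s hs
    exact Real.smoothTransition.one_of_one_le ((one_le_div hba).2 (by linarith [mem_Ioi.1 hs]))
  · intro t ht
    exact Real.smoothTransition.pos_of_pos (div_pos (sub_pos.2 ht) hba)

/-! ### Linear algebra: injective endomorphisms of `ℝ⁴` are boundedly invertible, stably -/

/-- An injective endomorphism of `ℝ⁴` is bounded below: `‖u‖ ≤ K ‖B u‖`. [folklore] -/
theorem exists_bound_of_injective {B : EuclideanSpace ℝ (Fin 4) →L[ℝ] EuclideanSpace ℝ (Fin 4)}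
    (hB : Function.Injective B) :
    ∃ K : ℝ, 0 < K ∧ ∀ u : EuclideanSpace ℝ (Fin 4), ‖u‖ ≤ K * ‖B u‖ := by
  let e : EuclideanSpace ℝ (Fin 4) ≃ₗ[ℝ] EuclideanSpace ℝ (Fin 4) :=
    LinearEquiv.ofInjectiveEndo (B : EuclideanSpace ℝ (Fin 4) →ₗ[ℝ] EuclideanSpace ℝ (Fin 4)) hB
  let e' : EuclideanSpace ℝ (Fin 4) ≃L[ℝ] EuclideanSpace ℝ (Fin 4) := e.toContinuousLinearEquiv
  have he : ∀ u, e' u = B u := fun u => rfl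
  refine ⟨‖(e'.symm : EuclideanSpace ℝ (Fin 4) →L[ℝ] EuclideanSpace ℝ (Fin 4))‖ + 1,
    by positivity, fun u => ?_⟩
  have h1 : e'.symm (B u) = u := by rw [← he, e'.symm_apply_apply]
  calc ‖u‖ = ‖(e'.symm : EuclideanSpace ℝ (Fin 4) →L[ℝ] EuclideanSpace ℝ (Fin 4)) (B u)‖ := by
        rw [ContinuousLinearEquiv.coe_coe, h1]
    _ ≤ ‖(e'.symm : EuclideanSpace ℝ (Fin 4) →L[ℝ] EuclideanSpace ℝ (Fin 4))‖ * ‖B u‖ :=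
        (e'.symm : EuclideanSpace ℝ (Fin 4) →L[ℝ] EuclideanSpace ℝ (Fin 4)).le_opNorm _
    _ ≤ (‖(e'.symm : EuclideanSpace ℝ (Fin 4) →L[ℝ] EuclideanSpace ℝ (Fin 4))‖ + 1) * ‖B u‖ := by
        gcongr
        linarith

/-- A lower bound `‖u‖ ≤ K ‖B₀ u‖` survives, with constant `2K`, a perturbation of operator norm
at most `(2K)⁻¹`. [folklore] -/
theorem bound_of_norm_sub_le {B B₀ : EuclideanSpace ℝ (Fin 4) →L[ℝ] EuclideanSpace ℝ (Fin 4)}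
    {K : ℝ} (hK : 0 < K) (h₀ : ∀ u : EuclideanSpace ℝ (Fin 4), ‖u‖ ≤ K * ‖B₀ u‖)
    (hB : ‖B - B₀‖ ≤ (2 * K)⁻¹) (u : EuclideanSpace ℝ (Fin 4)) :
    ‖u‖ ≤ 2 * K * ‖B u‖ := by
  have h1 : ‖B₀ u‖ ≤ ‖B u‖ + ‖(B - B₀) u‖ := by
    have h : B₀ u = B u - (B - B₀) u := by simp
    rw [h]
    exact norm_sub_le _ _
  have h2 : ‖(B - B₀) u‖ ≤ (2 * K)⁻¹ * ‖u‖ :=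
    ((B - B₀).le_opNorm u).trans (mul_le_mul_of_nonneg_right hB (norm_nonneg _))
  have h3 : K * ‖B₀ u‖ ≤ K * ‖B u‖ + ‖u‖ / 2 := by
    calc K * ‖B₀ u‖ ≤ K * (‖B u‖ + (2 * K)⁻¹ * ‖u‖) :=
          mul_le_mul_of_nonneg_left (h1.trans (by linarith)) hK.le
      _ = K * ‖B u‖ + ‖u‖ / 2 := by
          field_simp
  linarith [h₀ u]

/-- `Dι(z)` is injective for `z ≠ 0` (`ι ∘ ι = id`, chain rule). [folklore] -/
theorem fderiv_inversion_injective {z : EuclideanSpace ℝ (Fin 4)} (hz : z ≠ 0) :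
    Function.Injective (fderiv ℝ inversion z) := by
  have h1 : HasFDerivAt inversion (fderiv ℝ inversion z) z :=
    (differentiableAt_inversion hz).hasFDerivAt
  have h2 : HasFDerivAt inversion (fderiv ℝ inversion (inversion z)) (inversion z) :=
    (differentiableAt_inversion (inversion_ne_zero hz)).hasFDerivAt
  have h3 : HasFDerivAt (inversion ∘ inversion)
      ((fderiv ℝ inversion (inversion z)).comp (fderiv ℝ inversion z)) z := h2.comp z h1
  have h4 : (inversion ∘ inversion : EuclideanSpace ℝ (Fin 4) → EuclideanSpace ℝ (Fin 4)) = id :=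
    funext inversion_inversion
  rw [h4] at h3
  have h5 : (fderiv ℝ inversion (inversion z)).comp (fderiv ℝ inversion z) =
      ContinuousLinearMap.id ℝ (EuclideanSpace ℝ (Fin 4)) := h3.unique (hasFDerivAt_id z)
  have h6 : Function.LeftInverse (fderiv ℝ inversion (inversion z)) (fderiv ℝ inversion z) :=
    fun a => by
      have := congrArg (fun L : EuclideanSpace ℝ (Fin 4) →L[ℝ] EuclideanSpace ℝ (Fin 4) => L a) h5
      simpa using this
  exact h6.injective

/-! ### Constants on compact sets -/

/-- A property of points given by a constant, monotone in the constant and checked with one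
constant near each point of a compact set, holds on the compact set with one constant.
[folklore] -/
theorem exists_const_of_isCompact {X : Type*} [TopologicalSpace X] {K : Set X} (hK : IsCompact K)
    {P : ℝ → X → Prop} (hmono : ∀ C C' x, C ≤ C' → P C x → P C' x)
    (hloc : ∀ x ∈ K, ∃ C : ℝ, 0 ≤ C ∧ ∀ᶠ z in 𝓝 x, P C z) :
    ∃ C : ℝ, 0 ≤ C ∧ ∀ x ∈ K, P C x := by
  refine hK.induction_on (p := fun s => ∃ C : ℝ, 0 ≤ C ∧ ∀ x ∈ s, P C x) ?_ ?_ ?_ ?_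
  · exact ⟨0, le_rfl, fun x hx => (notMem_empty x hx).elim⟩
  · rintro s t hst ⟨C, hC, h⟩
    exact ⟨C, hC, fun x hx => h x (hst hx)⟩
  · rintro s t ⟨C₁, hC₁, h₁⟩ ⟨C₂, hC₂, h₂⟩
    refine ⟨max C₁ C₂, le_max_of_le_left hC₁, fun x hx => ?_⟩
    rcases hx with hx | hx
    · exact hmono _ _ _ (le_max_left _ _) (h₁ x hx)
    · exact hmono _ _ _ (le_max_right _ _) (h₂ x hx)
  · intro x hx
    obtain ⟨C, hC, hev⟩ := hloc x hx
    exact ⟨_, mem_nhdsWithin_of_mem_nhds hev, C, hC, fun z hz => hz⟩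

/-! ### Positivity of a witness on semipositive forms -/

/-- **Positivity.** If some smooth form `β` tames `J` everywhere, a taming witness `T` at
radius `ε` is non-negative on every smooth form `α` that is `J`-SEMIpositive off the punctured
`ε`-ball: `α + s β` tames `J` off the ball for every `s > 0`, so (W1) gives `T α + s T β > 0`.
[cite: Sullivan1976, Thm. I.7] -/
theorem tamingWitness_nonneg_of_semipositive
    {M : Type*} [TopologicalSpace M] [ChartedSpace (EuclideanSpace ℝ (Fin 4)) M] [T1Space M]
    {p : M} {ε : ℝ}
    {J : ∀ x : punctured p, TangentSpace (𝓡 4) x →L[ℝ] TangentSpace (𝓡 4) x}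
    {T : MForm (𝓡 4) (punctured p) ℝ 2 →ₗ[ℝ] ℝ} (hT : TamingWitness p ε J T)
    {β : MForm (𝓡 4) (punctured p) ℝ 2} (hβ : IsSmoothForm β)
    (hβt : ∀ (x : punctured p) (v : TangentSpace (𝓡 4) x), v ≠ 0 → 0 < β x ![v, J x v])
    {α : MForm (𝓡 4) (punctured p) ℝ 2} (hα : IsSmoothForm α)
    (hpos : ∀ x : punctured p, ¬ InPuncturedChartBall p ε x →
      ∀ v : TangentSpace (𝓡 4) x, 0 ≤ α x ![v, J x v]) :
    0 ≤ T α := by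
  by_contra hneg
  have hneg' : T α < 0 := lt_of_not_ge hneg
  have hTβ : 0 < T β := hT.pos_of_tames hβ fun x _ v hv => hβt x v hv
  set s : ℝ := -T α / (2 * T β) with hs
  have hs0 : 0 < s := div_pos (by linarith) (by linarith)
  have htame : TamesOffBall p ε J (α + s • β) := by
    intro x hx v hv
    have h1 := hpos x hx v
    have h2 := hβt x v hv
    show 0 < (α x + s • β x) ![v, J x v]
    rw [ContinuousAlternatingMap.add_apply, ContinuousAlternatingMap.smul_apply, smul_eq_mul]
    nlinarith
  have h := hT.pos_of_tames (hα.add (hβ.smul s)) htame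
  rw [map_add, map_smul, smul_eq_mul] at h
  have h3 : s * T β = -T α / 2 := by
    rw [hs]
    field_simp
  linarith

/-- **Positivity on a punctured homotopy sphere** (registered sub-goal `stub_collar_positivity`
of `stub_collar`): if a smooth form `β` tames `J` everywhere, a taming witness `T` at radius `ε`
is non-negative on every smooth `2`-form that is `J`-semipositive off the punctured `ε`-ball.
[cite: Sullivan1976, Thm. I.7] -/
theorem stub_collar_positivity :
    ∀ (S : HomotopySphere 4) (p : S.carrier)
      (J : ∀ x : punctured p, TangentSpace (𝓡 4) x →L[ℝ] TangentSpace (𝓡 4) x) (ε : ℝ)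
      (T : MForm (𝓡 4) (punctured p) ℝ 2 →ₗ[ℝ] ℝ), TamingWitness p ε J T →
      ∀ (β : MForm (𝓡 4) (punctured p) ℝ 2), IsSmoothForm β →
      (∀ (x : punctured p) (v : TangentSpace (𝓡 4) x), v ≠ 0 → 0 < β x ![v, J x v]) →
      ∀ (α : MForm (𝓡 4) (punctured p) ℝ 2), IsSmoothForm α →
      (∀ x : punctured p, ¬ InPuncturedChartBall p ε x →
        ∀ v : TangentSpace (𝓡 4) x, 0 ≤ α x ![v, J x v]) → 0 ≤ T α := by
  intro S p J ε T hT β hβ hβt α hα hpos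
  exact tamingWitness_nonneg_of_semipositive hT hβ hβt hα hpos

end Summit.SmoothPoincare4.SmoothPoincare4.Theorems.WitnessCharge.PencilIncompleteness
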